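import Mathlib
import Summits.BirchSwinnertonDyer.BirchSwinnertonDyer.Theorems.KatoDescentTamePotSupersingularTameLowerFibreAdjointBricksFiveLevels

/-!
# Bricks for the `GL₂(𝔽₅)`-lifting route (T5′), XVI: the passage to the limit (h)

Continuation of file XV (`…AdjointBricksFiveLevels`, same namespace). ARM-P r07 S7 ADD-1 §C (C0) (T5′): «a closed
`G ≤ GL₂(A)`, `A` complete local noetherian with residual image `GL₂(𝔽₅)`, contains a conjugate of
`SL₂(W(𝔽₅)_A) = SL₂(ℤ₅)`». Files IX–XV prove it at every finite level `A/𝔪ⁿ` (any residue field of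
characteristic `5`); this file is (h), the limit, in INSTANCE-FREE form (no topology, no `ℤ₅`): for a
commutative ring `A` and an ideal `𝔪` with `A` `𝔪`-adically precomplete (`IsPrecomplete 𝔪 A`), finite levels
`A/𝔪ⁿ`, `5 ∈ 𝔪 ∌ 1` and every element off `𝔪` a unit (e.g. `A = 𝒪_𝔭` the ring of integers of a finite
extension of `ℚ₅`, `𝔪 = 𝔭`), and a subgroup `G ≤ GL₂(A)` that is CLOSED (`g ∈ G` as soon as `g` is
congruent modulo every `𝔪ⁿ` to an element of `G`) and covers `GL₂(𝔽₅)` modulo `𝔪`: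

* `exists_conj_proSmu_le_of_closed` — **there is `u ∈ GL₂(A)`, `u ≡ 1 (mod 𝔪)`, with `u · g · u⁻¹ ∈ G` for
  every `g ∈ GL₂(A)` with `(det g)⁴ = 1` whose entries lie in the closure of `ℤ` (`∀ n`, `g ≡` an integer
  matrix `(mod 𝔪ⁿ)`)** — i.e. `u · S^μ(W̄) · u⁻¹ ⊆ G` for `W̄` = the closure of `ℤ·1` in `A` (= the image of
  `ℤ₅` when `A = 𝒪_𝔭`), in particular `u · SL₂(ℤ₅) · u⁻¹ ⊆ G`: Kato's (12.5.2) / Skinner–Urban's lattice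
  shape from the residual image `GL₂(𝔽₅)` alone, the `(2, 𝔽₅)` case excluded by [M] (Manoharmayum 2015) and
  false for residual image `SL₂(𝔽₅)`.

Proof: the level sets `U_k = {v ∈ GL₂(A/𝔪^{k+1}) : v ≡ 1, v·w·v⁻¹ ∈ G mod 𝔪^{k+1} ∀ integer-entry w with
det⁴ = 1}` are finite and non-empty (file XV `exists_levelGood`) and reduction maps `U_{k+1} → U_k`
(`levelGood_map_factor`); a compatible family exists (`nonempty_sections_of_finite_inverse_system`, Mathlib's
form of «a projective limit of non-empty finite sets is non-empty»); its entries converge in `A`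
(`IsPrecomplete`) to a matrix `u`, invertible as `det u ∉ 𝔪`; closedness of `G` concludes. With this file
the (T5′)/(P′) dossier of T-S7r07-1 (Δ1@5) is a kernel theorem in full generality (every local pair
`(A, 𝔪)` as above; no paper layer remains), modulo reading `𝒪_𝔭`, its topology and `ρ_g(G_ℚ)` (closed,
compact image) in this currency. Route-free, no definitions, nothing about elliptic curves or items
19618/19981 (open). Target T-S7r07-1 (`FibreLatticeInput 5`).
-/

set_option linter.dupNamespace false

open Matrix CategoryTheory

namespace Summit.BirchSwinnertonDyer.BirchSwinnertonDyer.Theorems.GL2F5AdjointBricks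

section limit

universe u

/-- **(T5′), the limit form (ARM-P r07 S7 ADD-1 §C (C0) + (h)).** Let `A` be a commutative ring, `𝔪` an
ideal with `A` `𝔪`-adically precomplete, all `A/𝔪^{n+1}` finite, `5 ∈ 𝔪`, `1 ∉ 𝔪`, and every element off
`𝔪` a unit. Let `G ≤ GL₂(A)` be closed for the `𝔪`-adic topology (entrywise) and cover `GL₂(𝔽₅)` modulo
`𝔪`. Then some `u ∈ GL₂(A)` with `u ≡ 1 (mod 𝔪)` conjugates into `G` every `g ∈ GL₂(A)` with `(det g)⁴ = 1`
and entries in the `𝔪`-adic closure of `ℤ` — so `u · SL₂(ℤ₅) · u⁻¹ ⊆ G` when `A ⊇ ℤ₅` (`A = 𝒪_𝔭`). -/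
theorem exists_conj_proSmu_le_of_closed (A : Type u) [CommRing A] (𝔪 : Ideal A) [IsPrecomplete 𝔪 A]
    (hfin : ∀ n : ℕ, Finite (A ⧸ 𝔪 ^ (n + 1))) (h5 : (5 : A) ∈ 𝔪) (h1 : (1 : A) ∉ 𝔪)
    (hloc : ∀ a : A, a ∉ 𝔪 → IsUnit a) (G : Subgroup (GL (Fin 2) A))
    (hclosed : ∀ g : GL (Fin 2) A, (∀ n : ℕ, ∃ g' ∈ G, ∀ i j, g.val i j - g'.val i j ∈ 𝔪 ^ n) → g ∈ G)
    (hres : ∀ q : GL (Fin 2) (ZMod 5), ∃ g ∈ G, ∀ i j, g.val i j - ((q.val i j).val : ℕ) ∈ 𝔪) :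
    ∃ u : GL (Fin 2) A, (∀ i j, u.val i j - (1 : Matrix (Fin 2) (Fin 2) A) i j ∈ 𝔪) ∧
      ∀ g : GL (Fin 2) A, Matrix.det (g : Matrix (Fin 2) (Fin 2) A) ^ 4 = 1 →
        (∀ (n : ℕ) (i j : Fin 2), ∃ z : ℤ, g.val i j - z ∈ 𝔪 ^ n) → u * g * u⁻¹ ∈ G := by
  classical
  -- the finite levels and their good sets
  let π : ∀ k : ℕ, A →+* A ⧸ 𝔪 ^ (k + 1) := fun k => Ideal.Quotient.mk (𝔪 ^ (k + 1))
  let P : ∀ k : ℕ, GL (Fin 2) (A ⧸ 𝔪 ^ (k + 1)) → Prop := fun k v =>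
    (∀ i j, Ideal.Quotient.factor (Ideal.pow_le_self (Nat.succ_ne_zero k)) (v.val i j) =
        (1 : Matrix (Fin 2) (Fin 2) (A ⧸ 𝔪)) i j) ∧
      ∀ w : GL (Fin 2) (A ⧸ 𝔪 ^ (k + 1)),
        Matrix.det (w : Matrix (Fin 2) (Fin 2) (A ⧸ 𝔪 ^ (k + 1))) ^ 4 = 1 →
        (∀ i j, ∃ z : ℤ, w.val i j = z) →
          v * w * v⁻¹ ∈ G.map (Matrix.GeneralLinearGroup.map (π k))
  let U : ℕ → Type u := fun k => {v : GL (Fin 2) (A ⧸ 𝔪 ^ (k + 1)) // P k v}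
  let red : ∀ k : ℕ, A ⧸ 𝔪 ^ (k + 1 + 1) →+* A ⧸ 𝔪 ^ (k + 1) := fun k =>
    Ideal.Quotient.factor (Ideal.pow_le_pow_right (Nat.succ_le_succ (Nat.le_succ k)))
  have hredπ : ∀ k a, red k (π (k + 1) a) = π k a := fun k a => Ideal.Quotient.factor_mk _ a
  let r : ∀ k : ℕ, U (k + 1) → U k := fun k x =>
    ⟨Matrix.GeneralLinearGroup.map (red k) x.1,
      levelGood_map_factor 𝔪 h5 h1 k (k + 1) (Nat.le_succ k) G x.1 x.2.1 x.2.2⟩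
  -- König's lemma: a compatible family of good conjugators
  let F : ℕᵒᵖ ⥤ Type u := Functor.ofOpSequence (X := U) (fun k => TypeCat.ofHom (r k))
  haveI : ∀ j : ℕᵒᵖ, Finite (F.obj j) := by
    intro j
    haveI := hfin j.unop
    show Finite (U j.unop)
    infer_instance
  haveI : ∀ j : ℕᵒᵖ, Nonempty (F.obj j) := by
    intro j
    obtain ⟨v, hv1, hv⟩ := exists_levelGood 𝔪 h5 h1 hloc j.unop (hfin j.unop) G hres
    exact ⟨(⟨v, hv1, hv⟩ : U j.unop)⟩
  obtain ⟨s, hs⟩ := nonempty_sections_of_finite_inverse_system F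
  let v : ∀ k : ℕ, U k := fun k => s (Opposite.op k)
  have hstep : ∀ k, r k (v (k + 1)) = v k := by
    intro k
    have h := hs (homOfLE (Nat.le_add_right k 1)).op
    rw [Functor.ofOpSequence_map_homOfLE_succ] at h
    exact h
  have hstep' : ∀ k, Matrix.GeneralLinearGroup.map (red k) (v (k + 1)).1 = (v k).1 := fun k =>
    congrArg Subtype.val (hstep k)
  -- lifts of the entries and their convergence
  have hlift : ∀ k i j, ∃ a : A, π k a = (v k).1.val i j := fun k i j => Ideal.Quotient.mk_surjective _
  choose a ha using hlift
  have hsucc : ∀ k i j, a (k + 1) i j - a k i j ∈ 𝔪 ^ (k + 1) := by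
    intro k i j
    rw [← Ideal.Quotient.mk_eq_mk_iff_sub_mem]
    show π k (a (k + 1) i j) = π k (a k i j)
    rw [ha k, ← hstep' k, Matrix.GeneralLinearGroup.map_apply, ← ha (k + 1), hredπ]
  have htel : ∀ d k i j, a (k + d) i j - a k i j ∈ 𝔪 ^ (k + 1) := by
    intro d
    induction d with
    | zero => intro k i j; rw [add_zero, sub_self]; exact Ideal.zero_mem _
    | succ d ih =>
      intro k i j
      have h1' : a (k + d + 1) i j - a (k + d) i j ∈ 𝔪 ^ (k + 1) :=
        Ideal.pow_le_pow_right (by omega) (hsucc (k + d) i j)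
      have e : a (k + (d + 1)) i j - a k i j = (a (k + d + 1) i j - a (k + d) i j) + (a (k + d) i j - a k i j) := by
        rw [← add_assoc]; ring
      rw [e]; exact Ideal.add_mem _ h1' (ih k i j)
  have hconv : ∀ i j, ∃ L : A, ∀ k, a k i j - L ∈ 𝔪 ^ (k + 1) := by
    intro i j
    let f : ℕ → A := fun n => if n = 0 then 0 else a (n - 1) i j
    have hf1 : ∀ n, f (n + 1) = a n i j := fun n => by
      simp only [f, Nat.add_one_ne_zero, ↓reduceIte, Nat.add_sub_cancel]
    have hf : ∀ {m n : ℕ}, m ≤ n → f m ≡ f n [SMOD (𝔪 ^ m • ⊤ : Submodule A A)] := by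
      intro m n hmn
      rw [SModEq.sub_mem, smul_eq_mul, Ideal.mul_top]
      rcases Nat.eq_zero_or_pos m with hm | hm
      · rw [hm, pow_zero, Ideal.one_eq_top]; exact Submodule.mem_top
      · obtain ⟨m', rfl⟩ : ∃ m', m = m' + 1 := ⟨m - 1, by omega⟩
        obtain ⟨d, rfl⟩ : ∃ d, n = m' + 1 + d := ⟨n - (m' + 1), by omega⟩
        have e : f (m' + 1) - f (m' + 1 + d) = -(a (m' + d) i j - a m' i j) := by
          rw [show m' + 1 + d = (m' + d) + 1 by omega, hf1, hf1, neg_sub]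
        rw [e]; exact (𝔪 ^ (m' + 1)).neg_mem (htel d m' i j)
    obtain ⟨L, hL⟩ := IsPrecomplete.prec' f hf
    refine ⟨L, fun k => ?_⟩
    have h := hL (k + 1)
    rw [SModEq.sub_mem, smul_eq_mul, Ideal.mul_top, hf1] at h
    exact h
  choose L hL using hconv
  -- the limit matrix `u`
  set u₀ : Matrix (Fin 2) (Fin 2) A := Matrix.of fun i j => L i j with hu₀
  have hu₀k : ∀ k, u₀.map (π k) = (v k).1.val := by
    intro k; ext i j
    rw [Matrix.map_apply, hu₀, Matrix.of_apply, ← ha k, Ideal.Quotient.mk_eq_mk_iff_sub_mem]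
    have h := (𝔪 ^ (k + 1)).neg_mem (hL i j k)
    rwa [neg_sub] at h
  have hdet : IsUnit (Matrix.det u₀) := by
    apply hloc
    intro hmem
    have h0 : π 0 (Matrix.det u₀) = 0 := by
      rw [Ideal.Quotient.eq_zero_iff_mem, zero_add, pow_one]; exact hmem
    have hd : π 0 (Matrix.det u₀) = Matrix.det (v 0).1.val := by
      rw [RingHom.map_det, RingHom.mapMatrix_apply, hu₀k 0]
    have hunit : IsUnit (Matrix.det (v 0).1.val) := by
      rw [← Matrix.GeneralLinearGroup.val_det_apply]; exact Units.isUnit _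
    rw [← hd, h0] at hunit
    haveI : Nontrivial (A ⧸ 𝔪 ^ (0 + 1)) := by
      refine ⟨⟨0, 1, fun h => h1 ?_⟩⟩
      have e : (Ideal.Quotient.mk (𝔪 ^ (0 + 1))) 1 = 0 := by rw [map_one]; exact h.symm
      rw [Ideal.Quotient.eq_zero_iff_mem, zero_add, pow_one] at e
      exact e
    exact not_isUnit_zero hunit
  set u : GL (Fin 2) A := Matrix.GeneralLinearGroup.mk'' u₀ hdet with hu
  have huk : ∀ k, Matrix.GeneralLinearGroup.map (π k) u = (v k).1 := fun k => Units.ext (hu₀k k)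
  refine ⟨u, fun i j => ?_, fun g hg4 hgz => ?_⟩
  · -- `u ≡ 1 (mod 𝔪)`
    have h := (v 0).2.1 i j
    rw [← huk 0, Matrix.GeneralLinearGroup.map_apply, Ideal.Quotient.factor_mk] at h
    rw [← Ideal.Quotient.mk_eq_mk_iff_sub_mem, h, Matrix.one_apply, Matrix.one_apply]
    split_ifs <;> simp
  · -- closedness
    apply hclosed
    intro n
    rcases Nat.eq_zero_or_pos n with hn | hn
    · refine ⟨1, G.one_mem, fun i j => ?_⟩
      rw [hn, pow_zero, Ideal.one_eq_top]; exact Submodule.mem_top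
    obtain ⟨k, rfl⟩ : ∃ k, n = k + 1 := ⟨n - 1, by omega⟩
    set w := Matrix.GeneralLinearGroup.map (π k) g with hw
    have hwz : ∀ i j, ∃ z : ℤ, w.val i j = z := by
      intro i j
      obtain ⟨z, hz⟩ := hgz (k + 1) i j
      refine ⟨z, ?_⟩
      rw [hw, Matrix.GeneralLinearGroup.map_apply, ← map_intCast (π k) z, Ideal.Quotient.mk_eq_mk_iff_sub_mem]
      exact hz
    have hw4 : Matrix.det (w : Matrix (Fin 2) (Fin 2) (A ⧸ 𝔪 ^ (k + 1))) ^ 4 = 1 := by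
      have hd : Matrix.det (w : Matrix (Fin 2) (Fin 2) (A ⧸ 𝔪 ^ (k + 1))) = π k (Matrix.det g.val) := by
        rw [hw, RingHom.map_det]; rfl
      rw [hd, ← map_pow, hg4, map_one]
    obtain ⟨g', hg'G, hg'eq⟩ := Subgroup.mem_map.1 ((v k).2.2 w hw4 hwz)
    refine ⟨g', hg'G, fun i j => ?_⟩
    rw [← Ideal.Quotient.mk_eq_mk_iff_sub_mem]
    have e : Matrix.GeneralLinearGroup.map (π k) (u * g * u⁻¹) = Matrix.GeneralLinearGroup.map (π k) g' := by
      rw [map_mul, map_mul, map_inv, huk, hg'eq]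
    have e2 := congrArg (fun x : GL (Fin 2) (A ⧸ 𝔪 ^ (k + 1)) => x.val i j) e
    simpa only [Matrix.GeneralLinearGroup.map_apply] using e2

end limit

end Summit.BirchSwinnertonDyer.BirchSwinnertonDyer.Theorems.GL2F5AdjointBricks
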